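import Literature.MathematicalPhysics.QuantumLattice.WeightedOpenClusterBounds
import Literature.MathematicalPhysics.QuantumLattice.PeriodicVariationalPressure
import HarnessLib

/-!
# Weighted open clusters for SUPERLATTICE-PERIODIC models and states: the translation-class identity modulo `L_q`,
# the weighted Anderson floor on the cell energy density (T = 0) and the cluster cap on the periodic pressure `P_q` (T > 0)

Topic `Literature/MathematicalPhysics/QuantumLattice` (family `hubbard`; crew hubbard-fast S2 «families of models: multi-band by decoration,
staggered fields, ionic / decorated Hubbard models — all SUPERLATTICE-PERIODIC»). `WeightedOpenClusterBounds` treats translation-covariant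
interactions and translation-invariant states. A decorated model (`decoratedHubbard`, `hubbardStaggered`, the sublattice atoms
`sublatticeVectorHopping` / `sublatticeOnSite` of `PeriodicSublatticeAndStaggeredTerms`, a three-band `CuO₂` model by decoration) is only
covariant under the rectangular superlattice `L_q = ⊕_i (q_i+1)ℤe_i` (`FermionInteraction.IsPeriodic q`), its natural states are the
`q`-periodic ones, its energy per site is the CELL ENERGY DENSITY `ē_q(ω) = |C|⁻¹ Σ_{c ∈ C} Re ε(pos c)` (`cellMeanEnergy`,
`PeriodicInteractionsCellEnergy`) and its pressure is `P_q` (`perVarPressure`, `PeriodicVariationalPressure`). This file is the periodic twin: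

* §1 `sum_filter_mem_eq_sum_filter_mem_shiftSet'`: re-rooting the regions through a site `y` by an ARBITRARY vector `u` (here: the superlattice
  part of `y`, so that the root `y − u = pos(res y)` is a cell point).
* §2 **THE TRANSLATION-CLASS IDENTITY MODULO `L_q`** (`IsPeriodic.sum_mul_expect_eq_of_admissible`): for `q`-periodic `Ψ` (finite range `R`)
  and `ω`, a finite window `B` and a weight `w` that is `L_q`-ADMISSIBLE of mass `M` — for every cell point `c` and every interacting shape
  `X ∋ pos c`: `Σ_{y ∈ B, res y = c, X + (y − pos c) ⊆ B} w(X + (y − pos c)) = M` (the superlattice translates of `X` inside `B` weigh `M`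
  in total) — one has `Σ_{X ⊆ B} w(X) ω(Ψ X) = M · Σ_{c ∈ C} ε(pos c) + w(∅) ω(Ψ∅)`, i.e. (`IsPeriodic.re_expect_localHamiltonian_reweight`)
  `Re ω(H^{Ψ^w}_B) = M·|C|·ē_q(ω) + w(∅)(Ψ∅)_{∅∅}` — EXACT, no collar.
* §3 **T = 0** (`IsPeriodic.le_mul_cellMeanEnergy_of_posSemidef_reweight`): `H^{Ψ^w}_B + G − q₀·1 ⪰ 0` with `G` killed by `q`-periodic states
  ⇒ `q₀ − w(∅)(Ψ∅) ≤ M·|C|·ē_q(ω)` for EVERY `q`-periodic `ω` — the weighted Anderson floor for decorated models (Cu–O clusters bound the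
  three-band cell energy; plaquette clusters with sublattice weights bound the ionic / staggered Hubbard models).
* §4 **T > 0** (`perVarPressure_le_log_partitionFn_reweight`): for an ALIGNED box `[0,n)^d` (`(q_i+1) ∣ n`), an `L_q`-admissible weight with
  `M·|C| = n^d`, every real `β` and every Hermitian `G` killed by `q`-periodic states:
  `n^d · P_q(β,Ψ) ≤ log Re Tr exp(−(βH^{Ψ^w}_{[0,n)^d} − G)) + β w(∅)(Ψ∅)_{∅∅}` (aligned-box entropy cap
  `IsPeriodic.entropyDensitySup_le_boxEntropyDensity` + Gibbs + §2; compare the collar form `perVarPressure_le_log_partitionFn_box`).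
* §5 admissible multipliers: superlattice-translation differences `Γ A − Γ τ_ℓ A`, `ℓ ∈ L_q`, are killed by every `q`-periodic state.

Everything is PROVED; no definition (the reweighted interaction is the literal `⟨fun X ↦ (w X : ℂ) • Ψ.Φ X⟩`), no named fact, no number.

## Mathlib / tree search

REUSED: `IsPeriodic.expect_apply_shiftSet_superlatVec`, `siteEnergy(_apply)`, `cellMeanEnergy`, `cellRes`, `cellPos`,
`eq_cellPos_cellRes_add_superlatVec` (`PeriodicInteractionsCellEnergy`); `perVarPressure_le`, `IsPeriodic.entropyDensitySup_le_boxEntropyDensity`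
(`PeriodicVariationalPressure`, `PeriodicStatesMeanEntropy`); `sum_sum_filter_mem_eq_sum_card_inter_smul`, `HasFiniteRange.subset_thicken_singleton`,
`expect_localHamiltonian_eq_sum`, `expect_empty_eq`; `IsPeriodic.expect_shiftSet_superlatVec`; `FermionInteraction.IsHermitian.reweight`
(`WeightedOpenClusterBounds`); `IsHermitian.vonNeumannEntropy_sub_mul_le_log_partitionFn`, `trace_rdm_mul`, `expect_re_nonneg_of_posSemidef`.
`lean search 'IsPeriodic.*reweight|admissible.*superlat|cellMeanEnergy.*PosSemidef'` (2026-08-28): nothing.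

## References

* P. W. Anderson, Phys. Rev. 83 (1951) 1260, eq. (2). [cite: Anderson1951, eq. (2)]
* R. Valentí, J. Stolze, P. J. Hirschfeld, Phys. Rev. B 43 (1991) 13743, §II. [cite: ValentiStolzeHirschfeld1991, §II]
* R. B. Israel, *Convexity in the Theory of Lattice Gases* (1979), Lemma II.3.1, Thm. I.2.4 (periodic interactions via enlarged cells).
  [cite: Israel1979, Lemma II.3.1]
* H. Araki, H. Moriya, Rev. Math. Phys. 15 (2003) 93, §4.1 Def. 4.5, Thm. 3.8 and §10. [cite: ArakiMoriya2003, §4.1 Def. 4.5]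
-/

noncomputable section

open scoped ComplexOrder BigOperators
open Finset Literature.InformationTheory.Entropy

namespace Literature.MathematicalPhysics.QuantumLattice

open Matrix HubbardWave0 Literature.Probability.LatticeModels ThermodynamicLimit
open scoped Matrix.Norms.L2Operator

namespace InfVolFermionState

variable {d : ℕ} {q : Fin d → ℕ} {Ψ : FermionInteraction d} {R : ℝ} {ω : InfVolFermionState d}

/-! ### §1 Re-rooting through a site by an arbitrary vector -/

/-- **Re-rooting by an arbitrary vector**: `Σ_{X ⊆ B, y ∈ X} g X = Σ_{X' ⊆ B − u, y − u ∈ X'} g (X' + u)`.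
[cite: BratteliRobinsonII1997, §6.2.4 (Prop. 6.2.38 ff.)] -/
theorem sum_filter_mem_eq_sum_filter_mem_shiftSet' {N : Type*} [AddCommMonoid N] (B : Finset (Site d)) (y u : Site d)
    (g : Finset (Site d) → N) :
    ∑ X ∈ B.powerset with y ∈ X, g X = ∑ X ∈ (shiftSet (-u) B).powerset with (y - u) ∈ X, g (shiftSet u X) := by
  refine Finset.sum_nbij' (fun X => shiftSet (-u) X) (fun X => shiftSet u X) (fun X hX => ?_) (fun X hX => ?_)
    (fun X _ => KrausPattern.shiftSet_shiftSet_neg u X) (fun X _ => KrausPattern.shiftSet_neg_shiftSet u X)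
    (fun X _ => by rw [KrausPattern.shiftSet_shiftSet_neg])
  · rw [Finset.mem_filter, Finset.mem_powerset] at hX ⊢
    refine ⟨Finset.map_subset_map.2 hX.1, ?_⟩
    rw [mem_shiftSet, sub_neg_eq_add, sub_add_cancel]
    exact hX.2
  · rw [Finset.mem_filter, Finset.mem_powerset] at hX ⊢
    refine ⟨?_, ?_⟩
    · have h : shiftSet u X ⊆ shiftSet u (shiftSet (-u) B) := Finset.map_subset_map.2 hX.1
      rwa [KrausPattern.shiftSet_shiftSet_neg] at h
    · rw [mem_shiftSet]
      exact hX.2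

/-- The superlattice part of a site: `y − pos(res y) = superlatVec q (y div periods)`. [cite: ArakiMoriya2003, §4.1] -/
theorem sub_cellPos_cellRes_eq_superlatVec (q : Fin d → ℕ) (y : Site d) :
    y - cellPos (cellRes q y) = superlatVec q (fun i => y i / ((q i : ℤ) + 1)) := by
  have h := eq_cellPos_cellRes_add_superlatVec q y
  rw [sub_eq_iff_eq_add']
  exact h

/-! ### §2 The translation-class identity modulo the superlattice -/

/-- **THE TRANSLATION-CLASS IDENTITY MODULO `L_q`.** For `Ψ` `q`-periodic of finite range `R`, `ω` `q`-periodic, a finite window `B` and an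
`L_q`-ADMISSIBLE weight `w` of mass `M` (for every cell point `c` and every interacting shape `X ∋ pos c`:
`Σ_{y ∈ B, res y = c, X + (y − pos c) ⊆ B} w(X + (y − pos c)) = M`):
`Σ_{X ⊆ B} w(X)·ω(Ψ X) = M · Σ_{c ∈ C} ε(pos c) + w(∅)·ω(Ψ∅)` (`ε` the site energy).
[cite: ValentiStolzeHirschfeld1991, §II] [cite: BratteliRobinsonII1997, §6.2.4 (Prop. 6.2.38 ff.)] -/
theorem IsPeriodic.sum_mul_expect_eq_of_admissible (hω : ω.IsPeriodic q) (hΨ : Ψ.IsPeriodic q) (hR : Ψ.HasFiniteRange R)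
    (B : Finset (Site d)) (w : Finset (Site d) → ℝ) (M : ℝ)
    (hw : ∀ (c : Cell q) (X : Finset (Site d)), cellPos c ∈ X → Ψ.Φ X ≠ 0 →
      ∑ y ∈ B with (cellRes q y = c ∧ shiftSet (y - cellPos c) X ⊆ B), w (shiftSet (y - cellPos c) X) = M) :
    ∑ X ∈ B.powerset, (w X : ℂ) * ω.expect X (Ψ.Φ X) =
      (M : ℂ) * ∑ c : Cell q, siteEnergy Ψ ω R (cellPos c) + (w ∅ : ℂ) * ω.expect ∅ (Ψ.Φ ∅) := by
  classical
  set φ : Finset (Site d) → ℂ := fun X => ω.expect X (Ψ.Φ X) with hφ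
  have hφ0 : ∀ X, Ψ.Φ X = 0 → φ X = 0 := fun X h => by simp only [hφ, h, map_zero]
  -- the superlattice part `u y` of a site and periodicity of `φ` along it
  set u : Site d → Site d := fun y => y - cellPos (cellRes q y) with hu
  have hφu : ∀ (y : Site d) (X : Finset (Site d)), φ (shiftSet (u y) X) = φ X := by
    intro y X
    simp only [hu, hφ]
    rw [sub_cellPos_cellRes_eq_superlatVec q y]
    exact hω.expect_apply_shiftSet_superlatVec hΨ _ X
  -- split off the empty region and insert `|X|·|X|⁻¹`
  have hsplit : ∑ X ∈ B.powerset, (w X : ℂ) * φ X =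
      ∑ X ∈ B.powerset, (X.card : ℂ) * ((X.card : ℂ)⁻¹ * ((w X : ℂ) * φ X)) + (w ∅ : ℂ) * φ ∅ := by
    rw [← Finset.sum_erase_add _ _ (Finset.empty_mem_powerset B)]
    have h2 : ∑ X ∈ B.powerset, (X.card : ℂ) * ((X.card : ℂ)⁻¹ * ((w X : ℂ) * φ X)) =
        ∑ X ∈ (B.powerset).erase ∅, (X.card : ℂ) * ((X.card : ℂ)⁻¹ * ((w X : ℂ) * φ X)) := by
      rw [← Finset.sum_erase_add _ _ (Finset.empty_mem_powerset B), Finset.card_empty, Nat.cast_zero, zero_mul, add_zero]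
    rw [h2]
    congr 1
    refine Finset.sum_congr rfl fun X hX => ?_
    have hne : X ≠ ∅ := (Finset.mem_erase.1 hX).1
    have hc : (X.card : ℂ) ≠ 0 := Nat.cast_ne_zero.2 (Finset.card_ne_zero.2 (Finset.nonempty_iff_ne_empty.2 hne))
    rw [mul_inv_cancel_left₀ hc]
  rw [hsplit]
  congr 1
  -- Fubini over the sites of `B`
  have hfub := sum_sum_filter_mem_eq_sum_card_inter_smul B B.powerset (fun X => (X.card : ℂ)⁻¹ * ((w X : ℂ) * φ X))
  have hfub' : ∑ X ∈ B.powerset, (X.card : ℂ) * ((X.card : ℂ)⁻¹ * ((w X : ℂ) * φ X)) =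
      ∑ y ∈ B, ∑ X ∈ B.powerset with y ∈ X, (X.card : ℂ)⁻¹ * ((w X : ℂ) * φ X) := by
    rw [hfub]
    refine Finset.sum_congr rfl fun X hX => ?_
    rw [Finset.mem_powerset] at hX
    rw [Finset.inter_eq_left.2 hX, nsmul_eq_mul]
  rw [hfub']
  -- re-root at the cell point `pos(res y)` by the superlattice vector `u y`
  set T : Cell q → Finset (Finset (Site d)) := fun c =>
    ((thicken ({cellPos c} : Finset (Site d)) R).powerset).filter fun X => cellPos c ∈ X with hTdef
  have hy : ∀ y ∈ B, ∑ X ∈ B.powerset with y ∈ X, (X.card : ℂ)⁻¹ * ((w X : ℂ) * φ X) =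
      ∑ X ∈ T (cellRes q y), if shiftSet (u y) X ⊆ B then (X.card : ℂ)⁻¹ * ((w (shiftSet (u y) X) : ℂ) * φ X) else 0 := by
    intro y _
    rw [sum_filter_mem_eq_sum_filter_mem_shiftSet' B y (u y)]
    have hroot : y - u y = cellPos (cellRes q y) := by simp only [hu]; abel
    rw [hroot]
    simp_rw [card_shiftSet, hφu]
    rw [← Finset.sum_filter]
    have hV : (T (cellRes q y)).filter (fun X => shiftSet (u y) X ⊆ B) =
        (((shiftSet (-(u y)) B).powerset).filter fun X => cellPos (cellRes q y) ∈ X).filter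
          fun X => X ⊆ thicken ({cellPos (cellRes q y)} : Finset (Site d)) R := by
      ext X
      simp only [hTdef, Finset.mem_filter, Finset.mem_powerset]
      constructor
      · rintro ⟨⟨h1, h2⟩, h3⟩
        refine ⟨⟨?_, h2⟩, h1⟩
        intro x hx
        rw [mem_shiftSet, sub_neg_eq_add]
        exact h3 (by rw [mem_shiftSet, add_sub_cancel_right]; exact hx)
      · rintro ⟨⟨h1, h2⟩, h3⟩
        refine ⟨⟨h3, h2⟩, ?_⟩
        intro x hx
        rw [mem_shiftSet] at hx
        have h := h1 hx
        rw [mem_shiftSet, sub_neg_eq_add, sub_add_cancel] at h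
        exact h
    rw [hV]
    refine (Finset.sum_filter_of_ne fun X hX hne => ?_).symm
    rw [Finset.mem_filter, Finset.mem_powerset] at hX
    by_contra hXt
    apply hne
    have h0 : Ψ.Φ X = 0 := by
      by_contra hΦ
      exact hXt (hR.subset_thicken_singleton hΦ hX.2)
    rw [hφ0 X h0, mul_zero, mul_zero]
  rw [Finset.sum_congr rfl hy]
  -- group the sites of `B` by residue class
  rw [← Finset.sum_fiberwise B (cellRes q) (fun y =>
    ∑ X ∈ T (cellRes q y), if shiftSet (u y) X ⊆ B then (X.card : ℂ)⁻¹ * ((w (shiftSet (u y) X) : ℂ) * φ X) else 0)]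
  rw [Finset.mul_sum]
  refine Finset.sum_congr rfl fun c _ => ?_
  -- on the fibre `res y = c`: `u y = y − pos c`, root `pos c`
  have hfib : ∑ y ∈ B with cellRes q y = c,
      ∑ X ∈ T (cellRes q y), (if shiftSet (u y) X ⊆ B then (X.card : ℂ)⁻¹ * ((w (shiftSet (u y) X) : ℂ) * φ X) else 0) =
      ∑ y ∈ B with cellRes q y = c,
        ∑ X ∈ T c, (if shiftSet (y - cellPos c) X ⊆ B then (X.card : ℂ)⁻¹ * ((w (shiftSet (y - cellPos c) X) : ℂ) * φ X) else 0) := by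
    refine Finset.sum_congr rfl fun y hy => ?_
    rw [Finset.mem_filter] at hy
    simp only [hu, hy.2]
  rw [hfib, Finset.sum_comm, siteEnergy_apply, Finset.mul_sum]
  refine Finset.sum_congr rfl fun X hX => ?_
  simp only [Finset.mem_filter, Finset.mem_powerset] at hX
  rw [← Finset.sum_filter, Finset.filter_filter]
  by_cases hΦ : Ψ.Φ X = 0
  · have h0 : ω.expect X (Ψ.Φ X) = 0 := hφ0 X hΦ
    simp only [hφ0 X hΦ, h0, mul_zero, Finset.sum_const_zero]
  · have h := hw c X hX.2 hΦ
    have h' : ∑ y ∈ B with (cellRes q y = c ∧ shiftSet (y - cellPos c) X ⊆ B), ((w (shiftSet (y - cellPos c) X) : ℝ) : ℂ) = (M : ℂ) := by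
      rw [← Complex.ofReal_sum, h]
    calc ∑ y ∈ B with (cellRes q y = c ∧ shiftSet (y - cellPos c) X ⊆ B), (X.card : ℂ)⁻¹ * ((w (shiftSet (y - cellPos c) X) : ℂ) * φ X)
        = (X.card : ℂ)⁻¹ * ((∑ y ∈ B with (cellRes q y = c ∧ shiftSet (y - cellPos c) X ⊆ B), (w (shiftSet (y - cellPos c) X) : ℂ)) * φ X) := by
          rw [Finset.sum_mul, Finset.mul_sum]
      _ = (M : ℂ) * ((X.card : ℂ)⁻¹ * φ X) := by rw [h']; ring

/-- **The reweighted open-cluster Hamiltonian in a periodic state**: `Re ω(H^{Ψ^w}_B) = M·|C|·ē_q(ω) + w(∅)(Ψ∅)_{∅∅}` for every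
`L_q`-admissible weight of mass `M` — no boundary term. [cite: ValentiStolzeHirschfeld1991, §II] [cite: BratteliRobinsonII1997, §6.2.4 (Prop. 6.2.38 ff.)] -/
theorem IsPeriodic.re_expect_localHamiltonian_reweight (hω : ω.IsPeriodic q) (hΨ : Ψ.IsPeriodic q) (hR : Ψ.HasFiniteRange R)
    (B : Finset (Site d)) (w : Finset (Site d) → ℝ) (M : ℝ)
    (hw : ∀ (c : Cell q) (X : Finset (Site d)), cellPos c ∈ X → Ψ.Φ X ≠ 0 →
      ∑ y ∈ B with (cellRes q y = c ∧ shiftSet (y - cellPos c) X ⊆ B), w (shiftSet (y - cellPos c) X) = M) :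
    (ω.expect B ((⟨fun X => (w X : ℂ) • Ψ.Φ X⟩ : FermionInteraction d).localHamiltonian B)).re =
      M * (Fintype.card (Cell q) : ℝ) * cellMeanEnergy q Ψ ω R + w ∅ * ((Ψ.Φ ∅) ∅ ∅).re := by
  rw [expect_localHamiltonian_eq_sum]
  have h : ∑ X ∈ B.powerset, ω.expect X (((⟨fun X => (w X : ℂ) • Ψ.Φ X⟩ : FermionInteraction d)).Φ X) =
      ∑ X ∈ B.powerset, (w X : ℂ) * ω.expect X (Ψ.Φ X) :=
    Finset.sum_congr rfl fun X _ => by rw [map_smul, smul_eq_mul]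
  have hC : (0 : ℝ) < Fintype.card (Cell q) := by exact_mod_cast Fintype.card_pos
  have hcell : (Fintype.card (Cell q) : ℝ) * cellMeanEnergy q Ψ ω R = ∑ c : Cell q, (siteEnergy Ψ ω R (cellPos c)).re := by
    rw [cellMeanEnergy, ← mul_assoc, mul_inv_cancel₀ hC.ne', one_mul]
  rw [h, hω.sum_mul_expect_eq_of_admissible hΨ hR B w M hw, expect_empty_eq, Complex.add_re, Complex.re_ofReal_mul,
    Complex.re_ofReal_mul, Complex.re_sum, mul_assoc, hcell]

/-! ### §3 T = 0: the weighted Anderson floor on the cell energy density of periodic states -/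

/-- **THE WEIGHTED ANDERSON FLOOR FOR SUPERLATTICE-PERIODIC MODELS.** If `H^{Ψ^w}_B + G − q₀·1 ⪰ 0` on the cluster Fock space, with
`G ∈ 𝔄_B` killed by every `q`-periodic state (`Re ω'(G) = 0`), then `q₀ − w(∅)(Ψ∅)_{∅∅} ≤ M·|C|·ē_q(ω)` for EVERY `q`-periodic `ω`
(decorated `CuO₂` / ionic / staggered models: one Cu–O cluster certificate bounds the cell energy of every periodic state).
[cite: Anderson1951, eq. (2)] [cite: ValentiStolzeHirschfeld1991, §II] -/
theorem IsPeriodic.le_mul_cellMeanEnergy_of_posSemidef_reweight (hω : ω.IsPeriodic q) (hΨ : Ψ.IsPeriodic q)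
    (hR : Ψ.HasFiniteRange R) (B : Finset (Site d)) (w : Finset (Site d) → ℝ) (M : ℝ)
    (hw : ∀ (c : Cell q) (X : Finset (Site d)), cellPos c ∈ X → Ψ.Φ X ≠ 0 →
      ∑ y ∈ B with (cellRes q y = c ∧ shiftSet (y - cellPos c) X ⊆ B), w (shiftSet (y - cellPos c) X) = M)
    {G : FermionOp B} (hG0 : ∀ ω' : InfVolFermionState d, ω'.IsPeriodic q → (ω'.expect B G).re = 0) {q₀ : ℝ}
    (hq : ((⟨fun X => (w X : ℂ) • Ψ.Φ X⟩ : FermionInteraction d).localHamiltonian B + G - (q₀ : ℂ) • (1 : FermionOp B)).PosSemidef) :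
    q₀ - w ∅ * ((Ψ.Φ ∅) ∅ ∅).re ≤ M * (Fintype.card (Cell q) : ℝ) * cellMeanEnergy q Ψ ω R := by
  have h0 := ω.expect_re_nonneg_of_posSemidef B hq
  rw [map_sub, map_add, map_smul, ω.expect_one, Complex.sub_re, Complex.add_re, smul_eq_mul, mul_one, Complex.ofReal_re,
    hω.re_expect_localHamiltonian_reweight hΨ hR B w M hw, hG0 ω hω] at h0
  linarith

/-! ### §4 T > 0: the weighted-cluster cap on the periodic variational pressure -/

/-- A real multiple of a Hermitian matrix minus a Hermitian matrix is Hermitian. [folklore] -/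
private theorem isHermitian_ofReal_smul_sub'' {m : Type*} {K G : Matrix m m ℂ} (hK : K.IsHermitian) (hG : G.IsHermitian)
    (c : ℝ) : ((c : ℂ) • K - G).IsHermitian := by
  have h1 : ((c : ℂ) • K).IsHermitian := by
    rw [Matrix.IsHermitian, Matrix.conjTranspose_smul, hK.eq, Complex.star_def, Complex.conj_ofReal]
  exact h1.sub hG

/-- **THE CLUSTER CAP ON `P_q` FOR SUPERLATTICE-PERIODIC MODELS.** For `Ψ` Hermitian, `q`-periodic of finite range `R` on `ℤ^d` (`d ≥ 1`),
an ALIGNED box `[0,n)^d` (`n ≥ 1`, `(q_i+1) ∣ n`), an `L_q`-admissible weight `w` with `M·|C| = n^d`, a Hermitian multiplier `G` killed by every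
`q`-periodic state, and every real `β`:
`n^d · P_q(β,Ψ) ≤ log Re Tr exp(−(β H^{Ψ^w}_{[0,n)^d} − G)) + β w(∅)(Ψ∅)_{∅∅}`. [cite: Israel1979, Lemma II.3.1]
[cite: ArakiMoriya2003, §4.1 Def. 4.5] [cite: ValentiStolzeHirschfeld1991, §II] -/
theorem perVarPressure_le_log_partitionFn_reweight (hd : 0 < d) (hH : Ψ.IsHermitian) (hΨ : Ψ.IsPeriodic q)
    (hR : Ψ.HasFiniteRange R) (β : ℝ) {n : ℕ} (hn : 1 ≤ n) (hnq : ∀ i, (q i + 1) ∣ n) (w : Finset (Site d) → ℝ) {M : ℝ}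
    (hM : M * (Fintype.card (Cell q) : ℝ) = (n : ℝ) ^ d)
    (hw : ∀ (c : Cell q) (X : Finset (Site d)), cellPos c ∈ X → Ψ.Φ X ≠ 0 →
      ∑ y ∈ halfOpenBox d n with (cellRes q y = c ∧ shiftSet (y - cellPos c) X ⊆ halfOpenBox d n),
        w (shiftSet (y - cellPos c) X) = M)
    {G : FermionOp (halfOpenBox d n)} (hGh : G.IsHermitian)
    (hG0 : ∀ ω' : InfVolFermionState d, ω'.IsPeriodic q → (ω'.expect (halfOpenBox d n) G).re = 0) :
    (n : ℝ) ^ d * Ψ.perVarPressure β q R ≤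
      Real.log (partitionFn 1 ((β : ℂ) • (⟨fun X => (w X : ℂ) • Ψ.Φ X⟩ : FermionInteraction d).localHamiltonian (halfOpenBox d n) -
        G)).re + β * (w ∅ * ((Ψ.Φ ∅) ∅ ∅).re) := by
  have hnd : (0 : ℝ) < (n : ℝ) ^ d := by positivity
  rw [← le_div_iff₀' hnd]
  refine Ψ.perVarPressure_le β q R fun ω hω => ?_
  rw [le_div_iff₀' hnd]
  have hKh := FermionInteraction.localHamiltonian_isHermitian (hH.reweight w) (halfOpenBox d n)
  have hG := (isHermitian_ofReal_smul_sub'' hKh hGh β).vonNeumannEntropy_sub_mul_le_log_partitionFn 1 (ω.rdm_posSemidef _)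
    (ω.trace_rdm _)
  rw [Matrix.mul_sub, Matrix.mul_smul, Matrix.trace_sub, Matrix.trace_smul, smul_eq_mul, trace_rdm_mul, trace_rdm_mul,
    Complex.sub_re, Complex.re_ofReal_mul, hG0 ω hω, sub_zero,
    hω.re_expect_localHamiltonian_reweight hΨ hR (halfOpenBox d n) w M hw, hM, one_mul] at hG
  have hS := hω.entropyDensitySup_le_boxEntropyDensity hd hn hnq
  rw [boxEntropyDensity_apply, le_div_iff₀ hnd] at hS
  nlinarith [hG, hS, mul_comm ((n : ℝ) ^ d) (ω.entropyDensitySup - β * cellMeanEnergy q Ψ ω R)]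

/-! ### §5 Admissible multipliers for periodic states: superlattice-translation differences -/

/-- **Superlattice-translation differences are killed by periodic states**: `Re ω(Γ A − Γ τ_ℓ A) = 0` for `A ∈ 𝔄_X`, `X, X + ℓ ⊆ Λ`,
`ℓ = superlatVec q z`, and every `q`-periodic `ω`. [cite: ArakiMoriya2003, §4.1 Def. 4.5] -/
theorem IsPeriodic.re_expect_fermionEmbed_sub_shift_superlatVec (hω : ω.IsPeriodic q) {X Λ : Finset (Site d)} (hX : X ⊆ Λ)
    (z : Fin d → ℤ) (hv : shiftSet (superlatVec q z) X ⊆ Λ) (A : FermionOp X) :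
    (ω.expect Λ (fermionEmbed (PolySite.incl hX) A -
      fermionEmbed (PolySite.incl hv) (fermionEmbed (PolySite.shiftEmb (superlatVec q z) X) A))).re = 0 := by
  rw [map_sub, ω.compatible hX, ω.compatible hv, hω.expect_shiftSet_superlatVec, sub_self, Complex.zero_re]

/-- **Real combinations of superlattice-translation differences are killed by periodic states** (the admissible multipliers of §3–§4).
[cite: ArakiMoriya2003, §4.1 Def. 4.5] -/
theorem IsPeriodic.re_expect_sum_sub_shift_superlatVec (hω : ω.IsPeriodic q) {Λ : Finset (Site d)} {ι : Type*} (s : Finset ι)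
    (X : ι → Finset (Site d)) (hX : ∀ j, X j ⊆ Λ) (z : ι → Fin d → ℤ) (hv : ∀ j, shiftSet (superlatVec q (z j)) (X j) ⊆ Λ)
    (A : ∀ j, FermionOp (X j)) (c : ι → ℝ) :
    (ω.expect Λ (∑ j ∈ s, (c j : ℂ) • (fermionEmbed (PolySite.incl (hX j)) (A j) -
      fermionEmbed (PolySite.incl (hv j)) (fermionEmbed (PolySite.shiftEmb (superlatVec q (z j)) (X j)) (A j))))).re = 0 := by
  rw [map_sum, Complex.re_sum]
  refine Finset.sum_eq_zero fun j _ => ?_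
  rw [map_smul, smul_eq_mul, Complex.re_ofReal_mul, hω.re_expect_fermionEmbed_sub_shift_superlatVec (hX j) (z j) (hv j) (A j),
    mul_zero]

end InfVolFermionState

end Literature.MathematicalPhysics.QuantumLattice

end
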